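import Mathlib.Topology.UrysohnsLemma
import Mathlib.Topology.MetricSpace.ProperSpace
import Mathlib.MeasureTheory.Constructions.BorelSpace.Basic
import Literature.Analysis.FunctionSpaces.PointConfigVagueTopology

/-!
# Tangent tightness, compactness II: vaguely continuous maps are count-measurable (line `FirstLemma`, crux stmt-AtomisticToContinuum-14135)

Helper file of the registered stub `stub_hardCoreLawsVaguelyCompact` (Kallenberg 2002, Lemma 16.15 +
Thm. 16.16 + Thm. A2.3 (ii), specialised to hard-core laws), namespace
`Summit.AtomisticToContinuum.HydrodynamicLimit.Theorems.KiferCompactification`.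

One half of Kallenberg's Thm. A2.3 (iv) ("the Borel σ-algebra of the vague topology is the count
σ-algebra") in the form needed to push laws back to configurations:

* `isOpen_setOf_natCast_le_count`: for `U ⊆ X` open, `{ω | n ≤ N_ω(U)}` is OPEN in the vague topology of
  `PointConfig X` (lower semicontinuity of counts of open sets: `n` points in `U` carry a `[0,1]`-valued
  bump `g ∈ C_c(U)` with `∑_{p ∈ ω} g p ≥ n`, Urysohn);
* `measurable_count_comp_of_isOpen`, `stub_measurableOfVagueContinuous` (REGISTERED stub of this helper
  file): a vaguely continuous map `S : α → PointConfig X` from a topological space with a σ-algebra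
  containing the open sets is measurable for the COUNT σ-algebra (Dynkin-system argument over the
  π-system of open sets, on the relatively compact windows `B(x₀, n + 1)`, using the counting measures
  `PointConfig.toMeasure`).

No new definitions. References: O. Kallenberg, *Foundations of Modern Probability* (2002), Thm. A2.3;
D. J. Daley, D. Vere-Jones, *An Introduction to the Theory of Point Processes* II (2008), Thm. 9.1.IV.
-/

noncomputable section

open MeasureTheory Set Filter Topology Function Metric
open scoped ENNReal

namespace Summit.AtomisticToContinuum.HydrodynamicLimit.Theorems.KiferCompactification

open Literature.Analysis.FunctionSpaces (PointConfig)

variable {X : Type*} [MetricSpace X] [ProperSpace X]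

/-! ## Counts of open sets are vaguely lower semicontinuous -/

/-- **Counts of open sets are vaguely lower semicontinuous**: for `U` open and `n : ℕ`, the event
`{ω | n ≤ N_ω(U)}` is open in the vague topology (choose `n` points of `ω` in `U` and a bump `g ∈ C_c`,
`0 ≤ g ≤ 1`, `g = 1` at these points, `g = 0` off `U`: then `∑_{p ∈ ω'} g p > n - 1` is a vague
neighbourhood of `ω` on which `N(U) ≥ n`). -/
theorem isOpen_setOf_natCast_le_count {U : Set X} (hU : IsOpen U) (n : ℕ) :
    IsOpen {ω : PointConfig X | (n : ℕ∞) ≤ ω.count U} := by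
  refine isOpen_iff_forall_mem_open.2 fun ω hω => ?_
  obtain ⟨t, htsub, htcard⟩ := Set.exists_subset_encard_eq (s := (ω : Set X) ∩ U) hω
  have htfin : t.Finite := Set.finite_of_encard_eq_coe htcard
  have htU : t ⊆ U := htsub.trans inter_subset_right
  obtain ⟨g, hgt, hgU, hgc, hg01⟩ := exists_continuous_one_zero_of_isCompact htfin.isCompact
    hU.isClosed_compl (disjoint_compl_right_iff_subset.2 htU)
  have hsuppU : support (g : X → ℝ) ⊆ U := fun x hx => by
    by_contra hxU
    exact hx (hgU hxU)
  refine ⟨{ω' | (n : ℝ) - 1 < ω'.sumFn g}, fun ω' hω' => ?_,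
    isOpen_lt continuous_const (PointConfig.continuous_sumFn' g.continuous hgc), ?_⟩
  · -- from the statistic to the count
    have hfin' := ω'.finite_inter_support hgc
    have hle : ω'.sumFn g ≤ hfin'.toFinset.card := by
      rw [ω'.sumFn_eq_sum hgc]
      calc ∑ p ∈ hfin'.toFinset, g p ≤ ∑ p ∈ hfin'.toFinset, (1 : ℝ) :=
            Finset.sum_le_sum fun p _ => (hg01 p).2
        _ = hfin'.toFinset.card := by rw [Finset.sum_const, nsmul_eq_mul, mul_one]
    have hn : n ≤ hfin'.toFinset.card := by
      have h1 : (n : ℝ) - 1 < hfin'.toFinset.card := lt_of_lt_of_le hω' hle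
      have h2 : (n : ℝ) < (hfin'.toFinset.card : ℝ) + 1 := by linarith
      exact Nat.lt_add_one_iff.1 (by exact_mod_cast h2)
    show (n : ℕ∞) ≤ ω'.count U
    calc (n : ℕ∞) ≤ (hfin'.toFinset.card : ℕ∞) := by exact_mod_cast hn
      _ = ((ω' : Set X) ∩ support (g : X → ℝ)).encard := hfin'.encard_eq_coe_toFinset_card.symm
      _ ≤ ω'.count U := Set.encard_le_encard (inter_subset_inter_right _ hsuppU)
  · -- `ω` lies in the neighbourhood
    show (n : ℝ) - 1 < ω.sumFn g
    have hfin := ω.finite_inter_support hgc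
    have hsub : htfin.toFinset ⊆ hfin.toFinset := by
      rw [Finite.toFinset_subset_toFinset]
      intro p hp
      refine ⟨(htsub hp).1, ?_⟩
      rw [mem_support, (hgt hp : g p = 1)]
      exact one_ne_zero
    have hcard : (htfin.toFinset.card : ℝ) = n := by
      have h := htfin.encard_eq_coe_toFinset_card
      rw [htcard] at h
      exact_mod_cast (ENat.coe_inj.1 h).symm
    have hge : (n : ℝ) ≤ ω.sumFn g := by
      rw [ω.sumFn_eq_sum hgc, ← hcard]
      calc (htfin.toFinset.card : ℝ) = ∑ p ∈ htfin.toFinset, g p := by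
            rw [Finset.sum_eq_card_nsmul (b := (1 : ℝ)) fun p hp => ?_, nsmul_eq_mul, mul_one]
            exact hgt (htfin.mem_toFinset.1 hp)
        _ ≤ ∑ p ∈ hfin.toFinset, g p :=
            Finset.sum_le_sum_of_subset_of_nonneg hsub fun p _ _ => (hg01 p).1
    linarith

/-! ## Vaguely continuous maps are count-measurable -/

section Measurable

variable {α : Type*} [TopologicalSpace α] [MeasurableSpace α] [OpensMeasurableSpace α]

/-- Counts of open sets along a vaguely continuous map are measurable (`{n ≤ N(U)}` pulls back to an
open set, and `{N(U) = n} = {n ≤ N(U)} \ {n + 1 ≤ N(U)}`). -/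
theorem measurable_count_comp_of_isOpen {S : α → PointConfig X} (hS : Continuous S) {U : Set X}
    (hU : IsOpen U) : Measurable fun a => (S a).count U := by
  refine ENat.measurable_iff.2 fun n => ?_
  have hO : ∀ m : ℕ, IsOpen {a | (m : ℕ∞) ≤ (S a).count U} := fun m =>
    (isOpen_setOf_natCast_le_count hU m).preimage hS
  have hrepr : (fun a => (S a).count U) ⁻¹' {(n : ℕ∞)} =
      {a | (n : ℕ∞) ≤ (S a).count U} \ {a | ((n + 1 : ℕ) : ℕ∞) ≤ (S a).count U} := by
    ext a
    simp only [mem_preimage, mem_singleton_iff, Set.mem_sdiff, mem_setOf_eq, not_le, Nat.cast_add,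
      Nat.cast_one]
    constructor
    · intro h
      rw [h]
      exact ⟨le_rfl, (ENat.lt_add_one_iff (ENat.coe_ne_top n)).2 le_rfl⟩
    · rintro ⟨h1, h2⟩
      exact le_antisymm ((ENat.lt_add_one_iff (ENat.coe_ne_top n)).1 h2) h1
  rw [hrepr]
  exact (hO n).measurableSet.diff (hO (n + 1)).measurableSet

/-- **Vaguely continuous maps are count-measurable** (one half of Kallenberg's Thm. A2.3 (iv): the count
σ-algebra is contained in the Borel σ-algebra of the vague topology, along any continuous map). For a proper
metric space `X` and a topological space `α` whose σ-algebra contains the open sets, every continuous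
`S : α → PointConfig X` (vague topology) is measurable for the count σ-algebra: by a Dynkin-system argument
over the π-system of open sets of `X`, inside the relatively compact windows `B(x₀, n + 1)`, the counting
measures `a ↦ (S a).toMeasure (s ∩ B(x₀, n + 1))` are measurable for all Borel `s`, and `N(s)` is their
supremum over `n`. Registered helper stub of line `FirstLemma`. -/
theorem stub_measurableOfVagueContinuous {X : Type*} [MetricSpace X] [ProperSpace X]
    [MeasurableSpace X] [BorelSpace X] {α : Type*} [TopologicalSpace α] [MeasurableSpace α]
    [OpensMeasurableSpace α] {S : α → PointConfig X} (hS : Continuous S) : Measurable S := by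
  rcases isEmpty_or_nonempty X with hX | ⟨⟨x₀⟩⟩
  · refine PointConfig.measurable_of_count fun s _ => ?_
    have h0 : ∀ a, (S a).count s = 0 := fun a => by
      rw [PointConfig.count, Set.eq_empty_of_isEmpty (_ ∩ s), Set.encard_empty]
    simp only [h0]
    exact measurable_const
  -- the windows
  set B : ℕ → Set X := fun n => ball x₀ ((n : ℝ) + 1) with hB
  have hBopen : ∀ n, IsOpen (B n) := fun n => isOpen_ball
  have hBfin : ∀ (ω : PointConfig X) (n : ℕ), ((ω : Set X) ∩ B n).Finite := fun ω n =>
    (ω.finite_inter_isCompact _ (isCompact_closedBall x₀ ((n : ℝ) + 1))).subset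
      (inter_subset_inter_right _ ball_subset_closedBall)
  have htop : ∀ (ω : PointConfig X) (n : ℕ) {s : Set X}, MeasurableSet s →
      ω.toMeasure (s ∩ B n) ≠ ∞ := by
    intro ω n s hs
    rw [PointConfig.toMeasure_apply _ (hs.inter (hBopen n).measurableSet)]
    have hlt : ω.count (s ∩ B n) < ⊤ :=
      lt_of_le_of_lt (ω.count_mono inter_subset_right) (hBfin ω n).encard_lt_top
    exact ENat.toENNReal_ne_top.2 hlt.ne
  -- open sets
  have hopen : ∀ {t : Set X}, IsOpen t → ∀ n, Measurable fun a => (S a).toMeasure (t ∩ B n) := by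
    intro t ht n
    have hmeas : MeasurableSet (t ∩ B n) := (ht.inter (hBopen n)).measurableSet
    simp only [PointConfig.toMeasure_apply _ hmeas]
    exact measurable_from_top.comp (measurable_count_comp_of_isOpen hS (ht.inter (hBopen n)))
  -- Dynkin induction over the π-system of open sets
  have hind : ∀ s, MeasurableSet s → ∀ n, Measurable fun a => (S a).toMeasure (s ∩ B n) := by
    intro s hs
    induction s, hs using MeasurableSet.induction_on_open with
    | isOpen t ht => exact hopen ht
    | compl t htm ih =>
      intro n
      have h_eq : ∀ a, (S a).toMeasure (tᶜ ∩ B n) =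
          (S a).toMeasure (univ ∩ B n) - (S a).toMeasure (t ∩ B n) := by
        intro a
        rw [univ_inter, ← measure_sdiff inter_subset_right
          (htm.inter (hBopen n).measurableSet).nullMeasurableSet (htop _ n htm)]
        congr 1
        ext x
        simp only [mem_inter_iff, mem_compl_iff, Set.mem_sdiff]
        tauto
      simp only [h_eq]
      exact (hopen isOpen_univ n).sub (ih n)
    | iUnion f hdisj hfm ih =>
      intro n
      have h_eq : ∀ a, (S a).toMeasure ((⋃ i, f i) ∩ B n) = ∑' i, (S a).toMeasure (f i ∩ B n) := by
        intro a
        rw [iUnion_inter]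
        exact measure_iUnion (fun i j hij => (hdisj hij).mono inter_subset_left inter_subset_left)
          fun i => (hfm i).inter (hBopen n).measurableSet
      simp only [h_eq, ENNReal.tsum_eq_iSup_sum]
      exact Measurable.iSup fun t => Finset.measurable_fun_sum t fun i _ => ih i n
  -- conclusion: `N(s) = sup_n N(s ∩ B n)`
  refine PointConfig.measurable_of_count fun s hs => ?_
  have hmono : Monotone fun n => s ∩ B n := fun m k hmk =>
    inter_subset_inter_right _ (ball_subset_ball (by simpa using (Nat.cast_le.2 hmk : (m : ℝ) ≤ k)))
  have hcoe : Measurable fun a => (S a).toMeasure s := by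
    have h_eq : ∀ a, (S a).toMeasure s = ⨆ n, (S a).toMeasure (s ∩ B n) := by
      intro a
      rw [← hmono.measure_iUnion, ← inter_iUnion]
      simp only [hB, iUnion_ball_nat_succ, inter_univ]
    simp only [h_eq]
    exact Measurable.iSup fun n => hind s hs n
  refine ENat.measurable_iff.2 fun n => ?_
  have hrepr : (fun a => (S a).count s) ⁻¹' {(n : ℕ∞)} =
      (fun a => (S a).toMeasure s) ⁻¹' {((n : ℕ∞) : ℝ≥0∞)} := by
    ext a
    simp only [mem_preimage, mem_singleton_iff, PointConfig.toMeasure_apply _ hs, ENat.toENNReal_inj]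
  rw [hrepr]
  exact hcoe (measurableSet_singleton _)

end Measurable

end Summit.AtomisticToContinuum.HydrodynamicLimit.Theorems.KiferCompactification
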